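import Summits.ResolutionOfSingularities.ResolutionOfSingularities.Theorems.MarkedTransferCampaignW46MohWindowShadeStallWalk
import Mathlib.Order.WellFounded
import HarnessLib

/-!
# [OURS · L1 W4.6] Rung (iii) "Moh window", SURFACES — TERMINATION: every infinite in-window walk of
  equimultiple point blow-ups in the Hauser–Wagner frame runs into the formal `p`-fold-curve case

Cell `res-hironaka`, rung L, slot W4.6 (restricted regimes as rungs), seat `res-L1-s46-pv-6` (gen 3).  The
TERMINATION half of the role of Th. 16.6 (2) / Th. 16.13 for the classical pair (order, shade) in regime (iii)
— purely inseparable `x^p + F`, `p ≤ ord F < 2p` at EVERY stage (design point (REG)) — for SURFACES (two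
residual letters `σ = {j, i}`), in the tree's transcription of [Hauser2010, §§F–G] (`PointBlowup.State/step/
shade/IsEquimultiplePoint`, `PointBlowupShade.lean`):

* `exists_formal_curve_of_walk` — let `s₀, s₁, …` be an INFINITE walk of point blow-ups of `x^p + F(y_j, y_i)`
  presented in the Hauser–Wagner frame (chart `c n ∈ {j, i}`, point `b n` on the new exceptional divisor, every
  translated point read in the chart `y_j`, the origin of the chart `y_i` being the vertical move — this
  presentation covers every closed point of every exceptional divisor), from a cleaned state with `y^r ∣ F`,
  every step equimultiple, every state inside the window.  Then some state `s_n` is in the formal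
  `p`-fold-curve case to every order: `∀ m, ∃ h w, h(0) = 0, dh(0) ≠ 0, ord(F_n − h^p·w) ≥ m`.
  CONTRAPOSITIVE (the rung): a walk of `p`-fold points of the surface that stays in the window and whose states
  are never formal `p`-th powers of smooth curves (times cofactors) — e.g. isolated `p`-fold points throughout —
  is FINITE.  The exclusion is NECESSARY: gen 2's two-cycles and fixed point (`…Cycle`, `…FixedPoint`) are
  infinite in-window walks on `F = y·h^p`, and `…NoInvariant` shows no invariant can do without it.
Proof: the shade is a natural number that never increases inside the window (gen 0,
`MohWindowShade.shade_step_le_of_lt_two_mul`), so it is eventually constant and the tail is a stall walk —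
`MohWindowShadeStallWalk.exists_formal_curve_of_stall_walk`.  OURS; replaces — for regime (iii) of RESCUE-SEED
W4.6, the classical pair, surfaces — the ROLE of the termination clause of Th. 16.13 (ms. p. 87 l. 25–29); NOT a
statement of the manuscript [claim: Hironaka2017, status: under-review], nothing of which is used.  AI review is
weaker than expert review.
-/

noncomputable section

set_option linter.dupNamespace false -- mandated namespace of this single-conjunct summit

open MvPolynomial Finset

namespace Summit.ResolutionOfSingularities.ResolutionOfSingularities.Theorems.CampaignW46.MohWindowShadeTermination

open Literature.AlgebraicGeometry.Resolution
open Literature.AlgebraicGeometry.Resolution.PointBlowup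
open Literature.AlgebraicGeometry.Resolution.Hauser2010
open MohWindowShadeStallWalk

variable {σ : Type*} {K : Type*} [Field K] [Fintype σ] [DecidableEq σ] [DecidableEq K]
variable (p : ℕ) [hp : Fact p.Prime] [CharP K p]

section TwoLetters

variable {j i : σ}

/-! ## §4. Every infinite in-window walk -/

/-- **[OURS · L1 W4.6] RUNG (iii), SURFACES, TERMINATION: every infinite in-window walk of equimultiple point
blow-ups presented in the Hauser–Wagner frame meets the formal `p`-fold-curve case.**  Hypotheses as in
`exists_formal_curve_of_stall_walk` but WITHOUT the stall hypothesis: the shade is a natural number that never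
increases inside the window (gen 0, `MohWindowShade.shade_step_le_of_lt_two_mul`), hence is eventually
constant, and the tail of the walk is a stall walk.  Contrapositive (the rung): an in-window walk of
equimultiple points of the surface `x^p + F(y_j, y_i)` whose every state is NOT a formal `p`-th power of a
smooth curve times a cofactor (e.g. whose `p`-fold locus stays a finite set of points) is FINITE.  The
exclusion is necessary: gen 2's two-cycles and fixed point (`…Cycle`, `…FixedPoint`) are infinite in-window
walks on `F = y·h^p`.  Replaces, for regime (iii) of RESCUE-SEED W4.6, the classical pair, surfaces, the ROLE
of the termination clause of Th. 16.13 (ms. p. 87 l. 25–29); NOT a statement of the manuscript. [folklore] -/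
theorem exists_formal_curve_of_walk (hij : i ≠ j) (htwo : ∀ l, l = j ∨ l = i) (s : ℕ → State σ K)
    (c : ℕ → σ) (b : ℕ → σ → K) (hb : ∀ n, b n (c n) = 0) (hHW : ∀ n, c n = i → ∀ l, b n l = 0)
    (hstep : ∀ n, s (n + 1) = step p (c n) (b n) (s n))
    (hclean : deletePthPowers p (s 0).F = (s 0).F) (hr : ∀ d ∈ (s 0).F.support, (s 0).r ≤ d)
    (heq : ∀ n, IsEquimultiplePoint p (c n) (b n) (s n))
    (hwin : ∀ n, (p : ℕ∞) ≤ ordZero (s n).F ∧ ordZero (s n).F < (2 * p : ℕ)) :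
    ∃ n, ∀ m : ℕ, ∃ h w : MvPolynomial σ K, coeff 0 h = 0 ∧ (∃ l, coeff (Finsupp.single l 1) h ≠ 0) ∧
      (m : ℕ∞) ≤ ordZero ((s n).F - h ^ p * w) := by
  classical
  have hinv := invariants_of_walk p hij htwo s c b hb hstep hclean hr heq hwin
  choose o ho hlo hhi using fun n => (hinv n).2.2
  have hcl : ∀ n, deletePthPowers p (s n).F = (s n).F := fun n => (hinv n).1
  have hrn : ∀ n, ∀ d ∈ (s n).F.support, (s n).r ≤ d := fun n => (hinv n).2.1
  have hshade : ∀ n, (s n).shade = ((o n - (s n).r.degree : ℕ) : ℕ∞) :=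
    fun n => shade_eq_of_ordZero_eq (s n) (ho n)
  -- the shade as a natural number, non-increasing (gen 0)
  set a : ℕ → ℕ := fun n => o n - (s n).r.degree with ha
  have hsucc : ∀ n, a (n + 1) ≤ a n := by
    intro n
    have hle : (s (n + 1)).shade ≤ (s n).shade := by
      rw [hstep n]
      exact MohWindowShade.shade_step_le_of_lt_two_mul p (c n) (b n) (hb n) (s n) (hcl n) (ho n)
        (hlo n).le (hhi n) (hrn n) (heq n)
    rw [hshade, hshade] at hle
    exact_mod_cast hle
  have hanti : Antitone a := antitone_nat_of_succ_le hsucc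
  -- a minimum is attained; from there on every step is a stall
  set n₀ := Function.argmin a with hn₀
  have hmin : ∀ n, a n₀ ≤ a n := fun n => not_lt.mp (Function.not_lt_argmin a n)
  have hstall : ∀ k, ¬ ShadeDrops p (c (n₀ + k)) (b (n₀ + k)) (s (n₀ + k)) := by
    intro k hdrop
    unfold ShadeDrops at hdrop
    rw [← hstep, hshade, hshade] at hdrop
    have h1 : a (n₀ + k + 1) < a (n₀ + k) := by exact_mod_cast hdrop
    have h2 := hmin (n₀ + k + 1)
    have h3 := hanti (show n₀ ≤ n₀ + k by omega)
    exact absurd (lt_of_lt_of_le h1 h3) (not_lt.mpr h2)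
  obtain ⟨n, hn⟩ := exists_formal_curve_of_stall_walk p hij htwo (fun k => s (n₀ + k))
    (fun k => c (n₀ + k)) (fun k => b (n₀ + k)) (fun k => hb (n₀ + k)) (fun k => hHW (n₀ + k))
    (fun k => by
      show s (n₀ + (k + 1)) = step p (c (n₀ + k)) (b (n₀ + k)) (s (n₀ + k))
      rw [show n₀ + (k + 1) = n₀ + k + 1 by omega]
      exact hstep (n₀ + k))
    (hcl n₀) (hrn n₀) (fun k => heq (n₀ + k)) (fun k => hwin (n₀ + k)) hstall
  exact ⟨n₀ + n, hn⟩

end TwoLetters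

end Summit.ResolutionOfSingularities.ResolutionOfSingularities.Theorems.CampaignW46.MohWindowShadeTermination
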